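import Summits.AtomisticToContinuum.HydrodynamicLimit.Theorems.LambertianContactSwapLambertianEulerKineticHeartOfInputs
import Summits.AtomisticToContinuum.HydrodynamicLimit.Theorems.LambertianContactSwapLambertianEulerCollisionalHeartOfInputs
import Summits.AtomisticToContinuum.HydrodynamicLimit.Theorems.LambertianContactSwapLambertianEulerInBandOfHearts
import Literature.MathematicalPhysics.KineticTheory.LambertianHardSphereFlow
import HarnessLib

/-!
# Scratch (crux-strategist s2, stmt-11854): AFTER the tenure retype — the guarded node split into the three research pieces

Simulates the route file after (i) `--restate LambertianEuler --new-decl-name LambertianEulerInBand --statement @inband_statement.txt`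
(s1, SPLIT-PACKAGE.md §A; body = `…HeartsLog.LambertianEulerInBand` in the named Λ-API) and (ii) `--split LambertianEulerInBand --into
children-inband.json --glue … --glue-decl-name LambertianEulerInBandOfInputs`: the generated glue item closes by
`…LambertianEulerSplit.lambertianEulerInBand_of_subs` (inlined), default heartbeats; NO dilute self-consistency anywhere.
-/

namespace Summit.AtomisticToContinuum.HydrodynamicLimit.Theses.LambertianContactSwapRetypedSim

open scoped BigOperators Topology Manifold Classical MeasureTheory ProbabilityTheory Matrix InnerProductSpace ComplexConjugate ContinuousMap
open Filter Set Function TopologicalSpace MeasureTheory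

/-- the RE-TYPED parent (tenure `--restate`, s1 inband_statement.txt verbatim). -/
def LambertianEulerInBand : Prop :=
  ∃ η₀ : ℝ, 0 < η₀ ∧ ∀ (a₀ θ₀ : Literature.MathematicalPhysics.KineticTheory.T3 → ℝ) (u₀ : Literature.MathematicalPhysics.KineticTheory.T3 → Literature.MathematicalPhysics.KineticTheory.V3), Continuous a₀ → Continuous θ₀ → Continuous u₀ → (∀ x, 0 < a₀ x) → (∀ x, 0 < θ₀ x) → ∃ σ₀ : ℝ, 0 < σ₀ ∧ ∀ σ : ℝ, 0 < σ → σ < σ₀ → ∀ (T : ℝ) (ρ θ : ℝ → Literature.MathematicalPhysics.KineticTheory.T3 → ℝ) (u : ℝ → Literature.MathematicalPhysics.KineticTheory.T3 → Literature.MathematicalPhysics.KineticTheory.V3), Literature.MathematicalPhysics.KineticTheory.IsHardSphereEulerSolution σ T ρ u θ → (∀ t ∈ Set.Ico 0 T, ∀ x, ρ t x * σ ^ 3 < η₀) → ∀ Φ : (N : ℕ) → Literature.Analysis.FluidPDE.HardSphereFlow (Literature.Analysis.FluidPDE.Torus.geometry (Fin 3)) (Literature.MathematicalPhysics.KineticTheory.hsDiameter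 σ N) (N + 1), Literature.MathematicalPhysics.KineticTheory.TendstoHydroFieldsAt (fun N => Literature.MathematicalPhysics.KineticTheory.localGibbsLaw σ a₀ u₀ θ₀ N (Φ N)) Φ ρ u θ 0 → ∀ t ∈ Set.Ico 0 T, ∀ χ : Literature.MathematicalPhysics.KineticTheory.T3 → ℝ, Continuous χ → ∀ δ > (0 : ℝ), Filter.Tendsto (fun N : ℕ => ((Literature.MathematicalPhysics.KineticTheory.localGibbsLaw σ a₀ u₀ θ₀ N (Φ N)).prod (Literature.MathematicalPhysics.KineticTheory.lambertNoise (Fin 3))) {p | δ < |Literature.MathematicalPhysics.KineticTheory.empiricalDensityField (Literature.MathematicalPhysics.KineticTheory.lambertFlow (Literature.Analysis.FluidPDE.Torus.geometry (Fin 3)) (Literature.MathematicalPhysics.KineticTheory.hsDiameter σ N) p.2 p.1 t) χ - ∫ x, χ x * ρ t x|}) Filter.atTop (nhds 0) ∧ Filter.Tendsto (fun N : ℕ => ((Literature.MathematicalPhysics.KineticTheory.localGibbsLaw σ a₀ u₀ θ₀ N (Φ N)).prod (Literature.MathematicalPhysics.KineticTheory.lambertNoise (Fin 3))) {p | δ <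 ‖Literature.MathematicalPhysics.KineticTheory.empiricalMomentumField (Literature.MathematicalPhysics.KineticTheory.lambertFlow (Literature.Analysis.FluidPDE.Torus.geometry (Fin 3)) (Literature.MathematicalPhysics.KineticTheory.hsDiameter σ N) p.2 p.1 t) χ - ∫ x, (χ x * ρ t x) • u t x‖}) Filter.atTop (nhds 0) ∧ Filter.Tendsto (fun N : ℕ => ((Literature.MathematicalPhysics.KineticTheory.localGibbsLaw σ a₀ u₀ θ₀ N (Φ N)).prod (Literature.MathematicalPhysics.KineticTheory.lambertNoise (Fin 3))) {p | δ < |Literature.MathematicalPhysics.KineticTheory.empiricalEnergyField (Literature.MathematicalPhysics.KineticTheory.lambertFlow (Literature.Analysis.FluidPDE.Torus.geometry (Fin 3)) (Literature.MathematicalPhysics.KineticTheory.hsDiameter σ N) p.2 p.1 t) χ - ∫ x, χ x * Literature.MathematicalPhysics.KineticTheory.totalEnergyDensity (ρ t x) (u t x) (θ t x)|}) Filter.atTop (nhds 0)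

/-- child 1 (crux). -/
def WindowLDLambda : Prop :=
  Summit.AtomisticToContinuum.HydrodynamicLimit.Theorems.LambertianContactSwapLambertianEulerKineticInputs.KineticClampedWindowLDLambda ∧ Summit.AtomisticToContinuum.HydrodynamicLimit.Theorems.LambertianContactSwapLambertianEulerCollisionalInputs.CollisionalClampedWindowLDLambda

/-- child 2 (crux). -/
def GaussianVelocityTailsLambda : Prop :=
  Summit.AtomisticToContinuum.HydrodynamicLimit.Theorems.LambertianContactSwapLambertianEulerKineticInputs.GaussianVelocityTailsLambda

/-- child 3 (crux). -/
def CollisionActivityTailsLambda : Prop :=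
  Summit.AtomisticToContinuum.HydrodynamicLimit.Theorems.LambertianContactSwapLambertianEulerCollisionalInputs.CollisionActivityTailsLambda

/-- the generated glue item of the in-band split (k = 3, no residual). -/
def LambertianEulerInBandOfInputs : Prop :=
  WindowLDLambda → GaussianVelocityTailsLambda → CollisionActivityTailsLambda → LambertianEulerInBand

/-- the re-typed parent IS the lead's named guarded Prop (delta/iota only). -/
theorem lambertianEulerInBand_iff :
    LambertianEulerInBand ↔
      Summit.AtomisticToContinuum.HydrodynamicLimit.Theorems.LambertianContactSwapLambertianEulerHeartsLog.LambertianEulerInBand :=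
  Iff.rfl

/-- **closing the in-band glue item** (= `…LambertianEulerSplit.lambertianEulerInBand_of_subs` inlined). -/
theorem lambertianEulerInBandOfInputs_holds : LambertianEulerInBandOfInputs :=
  fun hW hT hA =>
    Summit.AtomisticToContinuum.HydrodynamicLimit.Theorems.LambertianContactSwapLambertianEulerInBandOfHearts.lambertianEulerInBand_of_hearts
      (Summit.AtomisticToContinuum.HydrodynamicLimit.Theorems.LambertianContactSwapLambertianEulerKineticHeartOfInputs.kineticOneBlockInMeanLambdaLog_of_inputs
        hW.1 hT)
      (Summit.AtomisticToContinuum.HydrodynamicLimit.Theorems.LambertianContactSwapLambertianEulerCollisionalHeartOfInputs.collisionalOneBlockInMeanLambdaLog_of_inputs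
        hW.2 hA hT)

end Summit.AtomisticToContinuum.HydrodynamicLimit.Theses.LambertianContactSwapRetypedSim
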